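import Literature.Geometry.Kaehler.ComplexTorusAnalyticFibreClassConstant
import Literature.Geometry.Kaehler.ComplexTorusAnalyticCycleClassTranslation
import HarnessLib

/-!
# The moving lemma on a complex torus: `[Y₁] ∧ [Y₂] = ± cl(Y₁ ∩ (Y₂ − t))` for almost every translate `t`

Let `X = E/Λ` be a complex torus of dimension `g` (`Φ : ℝ^ι ≃ E` a basis of the lattice, `e` an
enumeration of `ι`, `rk Λ = n = 2g`), and let `Y₁, Y₂ ⊆ X` be closed analytic subsets of pure dimensions
`d₁, d₂` (codimensions `p₁, p₂`) with POSITIVE expected dimension of intersection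
`q = d₁ + d₂ − g > 0`. The group `X` acts transitively on itself by translations, every translation
is homotopic to the identity, and Kleiman's transversality of a general translate (Fulton, App. B.9.2;
Example 11.4.5: "the cycles `φ_g(V)·W` represent the class `V·W`") takes, for the de Rham classes
`[Y] ∈ H^{2p}(X, ℂ) = Alt^{2p}_ℝ(E; ℂ)` of the tree (`analyticCycleClass`), the following MEASURE-THEORETIC
form, proved here:

* `ae_wedge_analyticCycleClass_eq_smul_setCycleClass_inter_translate` — **THE MOVING LEMMA**: for
  Haar-almost every `t ∈ X`,
  `[Y₁]_e ∧ [Y₂]_e = sign(e) · cl_e(Y₁ ∩ (Y₂ − t))`,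
  where `cl_e(Z) = setCycleClass Φ e _ Z` is the analytic cycle class of `Z` when `Z` has pure dimension
  `q` and `0` otherwise — and for a.e. `t` these are the only two cases
  (`ae_inter_translate_eq_empty_or_hasPureDim`, valid for every `q ≥ 0`: Kleiman's part (a)). The sign
  `sign(e) = orientationSign Φ e = ±1` makes the identity orientation-free (each class `[·]_e` changes by
  `sign`, the left side twice, the right side once); it is `1` for a positively oriented enumeration.
* `ae_setCycleClass_inter_translate_eq`, `ae_cover_setCycleClass_inter_translate_eq` — the same
  identity read as `cl_e(Y₁ ∩ (Y₂ − t)) = sign(e) · [Y₁]_e ∧ [Y₂]_e`, for a.e. `t ∈ X`, resp. for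
  Lebesgue-a.e. `t ∈ E` (translate by `π(t)`).
* `ae_inter_translate_eq_empty_or_ae_hasPureDim` — EITHER a.e. `Y₁ ∩ (Y₂ − t) = ∅` OR a.e.
  `Y₁ ∩ (Y₂ − t)` is non-empty of pure dimension `q`, and
  `wedge_analyticCycleClass_eq_zero_iff_ae_inter_translate_eq_empty`,
  `wedge_analyticCycleClass_ne_zero_iff_ae_hasPureDim_inter_translate` — the first case is exactly
  `[Y₁] ∧ [Y₂] = 0`.
* `exists_wedge_analyticCycleClass_eq_smul_analyticCycleClass_inter_translate` — **the product of two
  effective analytic classes is `0` or (up to the orientation sign) the class of an actual closed analytic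
  subset of pure dimension `q`**: `A_eff · A_eff ⊆ A_eff ∪ {0}` in positive dimension.

* §3 CHOW'S MOVING LEMMA on a complex torus (`ae_analyticCycleClass_vadd_eq_and_inter_eq_empty_or_hasPureDim`,
  `exists_analyticCycleClass_vadd_eq_and_inter_eq_empty_or_hasPureDim`): for Haar-a.e. translate `t +ᵥ Y₂`
  (in particular for some translate) the class is unchanged, `[t +ᵥ Y₂] = [Y₂]` (`analyticCycleClass_vadd`),
  and `Y₁ ∩ (t +ᵥ Y₂)` is empty or of the expected pure dimension — every effective analytic class has an
  effective representative meeting a given `Y₁` properly (Fulton §11.4; Kleiman).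

Method (all in the tree): `[Y₁] ∧ [Y₂] = i₀^*[W]` for the analytic subset
`W = σ⁻¹(Y₁ × Y₂) = {(x, y) | x ∈ Y₁, x + y ∈ Y₂}` of `X × X`, `σ` the shear, `i₀ : x ↦ (x, 0)`
(`wedge_analyticCycleClass_eq_compContinuousLinearMap_inl`), whose fibres over the second factor are
`W_t = Y₁ ∩ (Y₂ − t)` (`shear_preimage_prod_fibre`); and the class of the generic fibre of an analytic
subset of `X₁ × X₂` of pure dimension `q + dim X₂`, `q > 0`, is the restriction of its class,
`cl(W_t) = ± i₀^*[W]` for a.e. `t` (`ae_setCycleClass_fibreSlice_eq_inl_pullback`, by slicing, Stokes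
and the constancy theorem). §1 transfers "Lebesgue-a.e. on `E`" to "Haar-a.e. on `X`" along the covering
map `π : E → X` (a measurable section of `π` and Weil's quotient formula for `ℝ^ι → (ℝ/ℤ)^ι`).

TODO(q = 0): intersection NUMBERS as numbers of points of `Y₁ ∩ (Y₂ − t)` (`d₁ + d₂ = g`) need the
`0`-dimensional fibre formula (area formula for the sheets), which the slicing files of the tree state
only for sheets of positive dimension.

Theorems only; no definitions, no instances, no named facts.

## References

* [Fulton1998] W. Fulton, *Intersection Theory*, 2nd ed., Springer 1998, §8.1–8.2 (intersection with the
  diagonal), Example 11.4.5 (translates by a group acting transitively represent the product),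
  Appendix B.9.2 (Kleiman's lemma), §10.2 Prop. 10.2, §19.2.
* [Kleiman1974Transversality] S. L. Kleiman, *The transversality of a general translate*, Compositio
  Math. 28 (1974) 287–297, Thm. 2.
* [Lange2023AbelianVarietiesComplex] H. Lange, *Abelian Varieties over the Complex Numbers*, Springer
  2023, §1.1.1 (`X = V/Λ`), §6.2.1–6.2.2 (cycle classes, the diagonal), §7.3.1.
* [BombieriGubler2001] E. Bombieri, W. Gubler, *Heights in Diophantine Geometry*, CUP 2006, App. C,
  Cor. C.1.2 (Haar measure of a quotient).
* [Federer1969] H. Federer, *Geometric Measure Theory*, Springer 1969, 4.3.1–4.3.2 (slicing).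
* [VoisinHodgeI2002] C. Voisin, *Hodge Theory and Complex Algebraic Geometry I*, CUP 2002, §11.1.2.
-/

noncomputable section

open scoped Manifold Topology ENNReal NNReal
open MeasureTheory MeasureTheory.Measure Set Function Filter Module TopologicalSpace WithLp Metric
open Literature.Geometry.GeometricMeasureTheory Literature.Analysis.Complex Literature.LinearAlgebra.Alternating

universe u

namespace Literature.Geometry.Kaehler

-- Nested operator-norm instances on `V [⋀^Fin m]→L[ℝ] F`, as in the tree's `Currents*.lean` files.
set_option maxSynthPendingDepth 2

namespace ComplexTorus

/-! ### §1 Null sets along the covering map `π : E → X`: Lebesgue-a.e. on `E` gives Haar-a.e. on `X` -/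

section Cover

variable {ι : Type*} [Fintype ι] {E : Type*} [NormedAddCommGroup E] [NormedSpace ℂ E] [MeasurableSpace E]
  [BorelSpace E] (Φ : (ι → ℝ) ≃L[ℝ] E)

omit [MeasurableSpace E] [BorelSpace E] in
/-- **A subset of the torus `(ℝ/ℤ)^ι` whose preimage in `ℝ^ι` is Lebesgue-null is Haar-null**: the
coordinates in `(0, 1]` give a measurable section `ψ` of the projection `ℝ^ι → (ℝ/ℤ)^ι` carrying the
Haar probability measure to Lebesgue measure on the cube `(0, 1]^ι` (Weil's formula for the quotient
`ℝ^ι/ℤ^ι`, one coordinate at a time), and `S = ψ⁻¹(π⁻¹ S)`.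
[cite: BombieriGubler2001, Appendix C Cor. C.1.2] -/
theorem volume_eq_zero_of_volume_preimage_proj_eq_zero {S : Set (ComplexTorus Φ)}
    (hS : (volume : Measure (ι → ℝ)) (proj Φ ⁻¹' S) = 0) : (volume : Measure (ComplexTorus Φ)) S = 0 := by
  -- a measurable section of `proj`: the coordinates in `(0, 1]`
  set ψ : ComplexTorus Φ → (ι → ℝ) := fun x i ↦ ((AddCircle.equivIoc 1 0 (x i) : ℝ)) with hψ
  have hsec : ∀ x, proj Φ (ψ x) = x := fun x ↦ by
    funext i
    rw [proj_apply]
    exact AddCircle.coe_equivIoc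
  have hval : MeasurePreserving (Subtype.val : Ioc (0 : ℝ) (0 + 1) → ℝ) (Measure.comap Subtype.val volume)
      ((volume : Measure ℝ).restrict (Ioc 0 (0 + 1))) :=
    ⟨measurable_subtype_coe, map_comap_subtype_coe measurableSet_Ioc _⟩
  have hcoord : MeasurePreserving (fun y : AddCircle (1 : ℝ) ↦ ((AddCircle.equivIoc 1 0 y : ℝ))) volume
      ((volume : Measure ℝ).restrict (Ioc 0 (0 + 1))) :=
    hval.comp (AddCircle.measurePreserving_equivIoc 1)
  have hψm : MeasurePreserving ψ (volume : Measure (ComplexTorus Φ))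
      (Measure.pi fun _ : ι ↦ (volume : Measure ℝ).restrict (Ioc 0 (0 + 1))) :=
    measurePreserving_pi (fun _ : ι ↦ (volume : Measure (AddCircle (1 : ℝ)))) _ fun _ ↦ hcoord
  have hSψ : S = ψ ⁻¹' (proj Φ ⁻¹' S) := by
    ext x
    rw [mem_preimage, mem_preimage, hsec]
  have hS' : (Measure.pi fun _ : ι ↦ (volume : Measure ℝ)) (proj Φ ⁻¹' S) = 0 := by
    rw [← volume_pi]; exact hS
  refine le_antisymm ?_ bot_le
  calc (volume : Measure (ComplexTorus Φ)) S = volume (ψ ⁻¹' (proj Φ ⁻¹' S)) := by rw [← hSψ]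
    _ ≤ (volume.map ψ) (proj Φ ⁻¹' S) := le_map_apply hψm.measurable.aemeasurable _
    _ = ((Measure.pi fun _ : ι ↦ (volume : Measure ℝ)).restrict (univ.pi fun _ ↦ Ioc (0 : ℝ) (0 + 1)))
          (proj Φ ⁻¹' S) := by
      rw [hψm.map_eq, Measure.restrict_pi_pi]
    _ ≤ (Measure.pi fun _ : ι ↦ (volume : Measure ℝ)) (proj Φ ⁻¹' S) :=
      Measure.le_iff'.1 Measure.restrict_le_self _
    _ = 0 := hS'

/-- **Lebesgue-a.e. in the universal cover is Haar-a.e. on the torus**: if a property holds at `π(t)`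
for `μ`-a.e. `t ∈ E` (`μ` any Haar = Lebesgue measure of `E`), it holds for Haar-a.e. point of
`X = E/Λ` (`π = proj ∘ Φ⁻¹`; Haar measures on `ℝ^ι` are equivalent, and §1's null-set transfer).
[cite: BombieriGubler2001, Appendix C Cor. C.1.2] [cite: Lange2023AbelianVarietiesComplex, §1.1.1] -/
theorem ae_volume_of_ae_cover {μ : Measure E} [μ.IsAddHaarMeasure] {p : ComplexTorus Φ → Prop}
    (h : ∀ᵐ t ∂μ, p (cover Φ t)) : ∀ᵐ x ∂(volume : Measure (ComplexTorus Φ)), p x := by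
  rw [ae_iff] at h ⊢
  refine volume_eq_zero_of_volume_preimage_proj_eq_zero Φ ?_
  -- Lebesgue measure on `ℝ^ι` is absolutely continuous w.r.t. the Haar measure `Φ⁻¹_* μ`
  have hmap : (μ.map (Φ.symm : E → ι → ℝ)) (proj Φ ⁻¹' {x | ¬ p x}) = 0 := by
    have hcoe : (μ.map (Φ.symm : E → ι → ℝ)) = μ.map (Φ.symm.toHomeomorph.toMeasurableEquiv) := by
      rw [Homeomorph.toMeasurableEquiv_coe, ContinuousLinearEquiv.coe_toHomeomorph]
    rw [hcoe, MeasurableEquiv.map_apply]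
    exact h
  exact absolutelyContinuous_isAddHaarMeasure (volume : Measure (ι → ℝ)) (μ.map (Φ.symm : E → ι → ℝ)) hmap

end Cover

/-! ### §2 The moving lemma -/

section Moving

variable {ι : Type*} [Fintype ι] [DecidableEq ι] {E : Type u} [NormedAddCommGroup E] [InnerProductSpace ℂ E]
  [FiniteDimensional ℂ E] [MeasurableSpace E] [BorelSpace E] (Φ : (ι → ℝ) ≃L[ℝ] E) {n : ℕ} (e : Fin n ≃ ι)
  {d₁ d₂ p₁ p₂ q : ℕ}

omit [DecidableEq ι] in
/-- The Euclidean Hausdorff measure `𝓗^{2 dim_ℂ E}` of `E` is a Haar (Lebesgue) measure. [folklore] -/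
private theorem isAddHaarMeasure_euclideanHausdorffMeasure_two_mul_finrank :
    (μHE[2 * finrank ℂ E] : Measure E).IsAddHaarMeasure := by
  letI : InnerProductSpace ℝ E := InnerProductSpace.complexToReal
  haveI : FiniteDimensional ℝ E := FiniteDimensional.complexToReal E
  have hV : finrank ℝ E = 2 * finrank ℂ E := by rw [finrank_real_of_complex]
  rw [← hV, InnerProductSpace.euclideanHausdorffMeasure_eq_volume]; infer_instance

/-- Re-reading the DIMENSION of the subset in its cycle class (`d = d'` propositionally): the two
classes agree up to the degree cast. [folklore] -/
private theorem analyticCycleClass_congr_dim_translate {ι' : Type*} [Fintype ι'] [DecidableEq ι'] {E' : Type u}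
    [NormedAddCommGroup E'] [InnerProductSpace ℂ E'] [FiniteDimensional ℂ E'] [MeasurableSpace E']
    [BorelSpace E'] (Φ' : (ι' → ℝ) ≃L[ℝ] E') {n' : ℕ} (e' : Fin n' ≃ ι') {Z : Set (ComplexTorus Φ')}
    {d d' k k' : ℕ} (hd : d = d') (hk : 2 * d + k = n') (hk' : 2 * d' + k' = n')
    (hZ : HasPureDim 𝓘(ℂ, E') Z d) (hZ' : HasPureDim 𝓘(ℂ, E') Z d') :
    analyticCycleClass Φ' e' hk' hZ' =
      (analyticCycleClass Φ' e' hk hZ).domDomCongr (finCongr (by omega : k = k')) := by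
  subst hd
  exact analyticCycleClass_eq_domDomCongr Φ' e' hk hk' hZ

/-- The class of the empty set is `0` (it has no pure dimension). [folklore] -/
private theorem setCycleClass_empty {k d : ℕ} (h : 2 * d + k = n) :
    setCycleClass Φ e h (∅ : Set (ComplexTorus Φ)) = 0 := by
  rw [setCycleClass, dif_neg]
  exact fun hp ↦ hp.nonempty.ne_empty rfl

open Classical in
/-- **The class of the intersection with a general translate is the cup product, translates from the
universal cover**: for `Y₁, Y₂ ⊆ X` closed analytic of pure dimensions `d₁, d₂`, codimensions `p₁, p₂`,
with `q = d₁ + d₂ − dim X > 0`, for Lebesgue-a.e. `t ∈ E`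
`cl_e(Y₁ ∩ (Y₂ − π t)) = sign(e) · [Y₁]_e ∧ [Y₂]_e` (`cl_e = setCycleClass Φ e`: the analytic cycle class if
the set has pure dimension `q`, else `0`). Proof: `[Y₁] ∧ [Y₂] = i₀^*[σ⁻¹(Y₁ × Y₂)]`, the fibre of
`σ⁻¹(Y₁ × Y₂)` over `π t` is `Y₁ ∩ (Y₂ − π t)`, and the generic fibre class is the restriction of the
class, `cl(W_t) = sign(e) sign(e ⊔ e) · i₀^*[W]`, with `sign(e ⊔ e) = sign(e)²  = 1`.
[cite: Fulton1998, Example 11.4.5 and Appendix B.9.2] [cite: Kleiman1974Transversality, Thm. 2]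
[cite: Lange2023AbelianVarietiesComplex, §6.2.2] -/
theorem ae_cover_setCycleClass_inter_translate_eq (hk₁ : 2 * d₁ + 2 * p₁ = n) (hk₂ : 2 * d₂ + 2 * p₂ = n)
    (hq : 2 * q + 2 * (p₁ + p₂) = n) (hq₀ : 0 < q) {Y₁ Y₂ : Set (ComplexTorus Φ)}
    (hY₁ : HasPureDim 𝓘(ℂ, E) Y₁ d₁) (hY₂ : HasPureDim 𝓘(ℂ, E) Y₂ d₂) :
    ∀ᵐ t ∂(μHE[2 * finrank ℂ E] : Measure E),
      setCycleClass Φ e hq (Y₁ ∩ (fun x ↦ x + cover Φ t) ⁻¹' Y₂) =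
        (orientationSign Φ e : ℂ) •
          ((analyticCycleClass Φ e hk₁ hY₁).wedge (analyticCycleClass Φ e hk₂ hY₂)).domDomCongr
            (finCongr (by ring : 2 * p₁ + 2 * p₂ = 2 * (p₁ + p₂))) := by
  have hng : finrank ℂ E * 2 = n := finrank_complex_mul_two Φ e
  have hg : 0 < finrank ℂ E := by omega
  have hdim : d₁ + d₂ = q + finrank ℂ E := by omega
  have hk' : 2 * (d₁ + d₂) + (2 * p₁ + 2 * p₂) = n + n := by omega
  have hk : 2 * (q + finrank ℂ E) + 2 * (p₁ + p₂) = n + n := by omega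
  -- the analytic subset `W = σ⁻¹(Y₁ × Y₂)` of `X × X`, of pure dimension `d₁ + d₂ = q + dim X`
  have hW₀ : HasPureDim 𝓘(ℂ, WithLp 2 (E × E))
      (mapMatrix (prodPeriodL2 Φ Φ) (prodPeriodL2 Φ Φ) (Matrix.fromBlocks 1 0 1 1) ⁻¹'
        (prodHomeomorphL2 Φ Φ ⁻¹' (Y₁ ×ˢ Y₂))) (d₁ + d₂) :=
    (isIsogeny_prodPeriodL2_shear Φ).hasPureDim_preimage (prodPeriodL2 Φ Φ) (prodPeriodL2 Φ Φ)
      (hasPureDim_preimage_prodHomeomorphL2_prod Φ Φ hY₁ hY₂)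
  have hW : HasPureDim 𝓘(ℂ, WithLp 2 (E × E))
      (mapMatrix (prodPeriodL2 Φ Φ) (prodPeriodL2 Φ Φ) (Matrix.fromBlocks 1 0 1 1) ⁻¹'
        (prodHomeomorphL2 Φ Φ ⁻¹' (Y₁ ×ˢ Y₂))) (q + finrank ℂ E) := hdim ▸ hW₀
  -- `[Y₁] ∧ [Y₂] = i₀^*[W]`
  have hcup := wedge_analyticCycleClass_eq_compContinuousLinearMap_inl Φ e hk₁ hk₂ hk' hY₁ hY₂
  -- the two readings of the class of `W`
  have hcl : analyticCycleClass (prodPeriodL2 Φ Φ) (sumEnum e e) hk hW =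
      (analyticCycleClass (prodPeriodL2 Φ Φ) (sumEnum e e) hk' hW₀).domDomCongr
        (finCongr (by ring : 2 * p₁ + 2 * p₂ = 2 * (p₁ + p₂))) :=
    analyticCycleClass_congr_dim_translate (prodPeriodL2 Φ Φ) (sumEnum e e) hdim hk' hk hW₀ hW
  -- the generic fibre class is the restriction of the class
  have hae := ae_setCycleClass_fibreSlice_eq_inl_pullback Φ Φ hg e (sumEnum e e) hq₀ hq hk hW
  -- the sign `sign(e) · sign(e ⊔ e) = sign(e)³ = sign(e)`
  have hsign : ((orientationSign Φ e * orientationSign (prodPeriod Φ Φ) (sumEnum e e) : ℤ) : ℂ) =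
      (orientationSign Φ e : ℂ) := by
    rw [orientationSign_sumEnum_eq_mul Φ Φ e e, ← mul_assoc, orientationSign_mul_self Φ e, one_mul]
  filter_upwards [hae] with t ht
  rw [shear_preimage_prod_fibre] at ht
  rw [ht, hsign, hcl, domDomCongr_finCongr_compContinuousLinearMap, ← hcup]

open Classical in
/-- **The class of the intersection with a general translate is the cup product**: for `Y₁, Y₂ ⊆ X`
closed analytic of pure dimensions `d₁, d₂` (codimensions `p₁, p₂`) with `q = d₁ + d₂ − dim X > 0`, for
Haar-a.e. `t ∈ X`, `cl_e(Y₁ ∩ (Y₂ − t)) = sign(e) · [Y₁]_e ∧ [Y₂]_e`.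
[cite: Fulton1998, Example 11.4.5 and Appendix B.9.2] [cite: Kleiman1974Transversality, Thm. 2]
[cite: Lange2023AbelianVarietiesComplex, §6.2.2] -/
theorem ae_setCycleClass_inter_translate_eq (hk₁ : 2 * d₁ + 2 * p₁ = n) (hk₂ : 2 * d₂ + 2 * p₂ = n)
    (hq : 2 * q + 2 * (p₁ + p₂) = n) (hq₀ : 0 < q) {Y₁ Y₂ : Set (ComplexTorus Φ)}
    (hY₁ : HasPureDim 𝓘(ℂ, E) Y₁ d₁) (hY₂ : HasPureDim 𝓘(ℂ, E) Y₂ d₂) :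
    ∀ᵐ t ∂(volume : Measure (ComplexTorus Φ)),
      setCycleClass Φ e hq (Y₁ ∩ (fun x ↦ x + t) ⁻¹' Y₂) =
        (orientationSign Φ e : ℂ) •
          ((analyticCycleClass Φ e hk₁ hY₁).wedge (analyticCycleClass Φ e hk₂ hY₂)).domDomCongr
            (finCongr (by ring : 2 * p₁ + 2 * p₂ = 2 * (p₁ + p₂))) := by
  haveI := isAddHaarMeasure_euclideanHausdorffMeasure_two_mul_finrank (E := E)
  exact ae_volume_of_ae_cover Φ
    (p := fun s ↦ setCycleClass Φ e hq (Y₁ ∩ (fun x ↦ x + s) ⁻¹' Y₂) =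
      (orientationSign Φ e : ℂ) •
        ((analyticCycleClass Φ e hk₁ hY₁).wedge (analyticCycleClass Φ e hk₂ hY₂)).domDomCongr
          (finCongr (by ring : 2 * p₁ + 2 * p₂ = 2 * (p₁ + p₂))))
    (ae_cover_setCycleClass_inter_translate_eq Φ e hk₁ hk₂ hq hq₀ hY₁ hY₂)

open Classical in
/-- **THE MOVING LEMMA on a complex torus.** For closed analytic subsets `Y₁, Y₂ ⊆ X` of pure
dimensions `d₁, d₂`, codimensions `p₁, p₂`, with positive expected dimension `q = d₁ + d₂ − dim X`, and
for Haar-almost every `t ∈ X`: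
`[Y₁]_e ∧ [Y₂]_e = sign(e) · cl_e(Y₁ ∩ (Y₂ − t))` in `H^{2(p₁+p₂)}(X, ℂ)`,
`cl_e` the analytic cycle class of the (closed analytic) set `Y₁ ∩ (Y₂ − t)` when it has pure dimension
`q` and `0` otherwise (a.e. the only two cases, `ae_inter_translate_eq_empty_or_hasPureDim`); for a
positively oriented enumeration `e` the sign is `1`. Fulton, Example 11.4.5: when a group acts
transitively, "`φ_g(V)` meets `W` properly for generic `g`", and "the cycles `φ_g(V)·W` represent the
class `V·W`" — here with all multiplicities one (generic transversality, Kleiman) absorbed into the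
almost-everywhere statement. [cite: Fulton1998, Example 11.4.5 and Appendix B.9.2]
[cite: Kleiman1974Transversality, Thm. 2] [cite: Lange2023AbelianVarietiesComplex, §7.3.1] -/
theorem ae_wedge_analyticCycleClass_eq_smul_setCycleClass_inter_translate (hk₁ : 2 * d₁ + 2 * p₁ = n)
    (hk₂ : 2 * d₂ + 2 * p₂ = n) (hq : 2 * q + 2 * (p₁ + p₂) = n) (hq₀ : 0 < q) {Y₁ Y₂ : Set (ComplexTorus Φ)}
    (hY₁ : HasPureDim 𝓘(ℂ, E) Y₁ d₁) (hY₂ : HasPureDim 𝓘(ℂ, E) Y₂ d₂) :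
    ∀ᵐ t ∂(volume : Measure (ComplexTorus Φ)),
      ((analyticCycleClass Φ e hk₁ hY₁).wedge (analyticCycleClass Φ e hk₂ hY₂)).domDomCongr
          (finCongr (by ring : 2 * p₁ + 2 * p₂ = 2 * (p₁ + p₂))) =
        (orientationSign Φ e : ℂ) • setCycleClass Φ e hq (Y₁ ∩ (fun x ↦ x + t) ⁻¹' Y₂) := by
  have hss : ((orientationSign Φ e : ℤ) : ℂ) * orientationSign Φ e = 1 := by
    exact_mod_cast orientationSign_mul_self Φ e
  filter_upwards [ae_setCycleClass_inter_translate_eq Φ e hk₁ hk₂ hq hq₀ hY₁ hY₂] with t ht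
  rw [ht, smul_smul, hss, one_smul]

/-- **Kleiman (a), a.e. form: the intersection with a general translate is empty or of the expected pure
dimension.** For `Y₁, Y₂ ⊆ X` closed analytic of pure dimensions `d₁, d₂` with `d₁ + d₂ = q + dim X`
(any `q ≥ 0`), for Haar-a.e. `t ∈ X` the closed analytic set `Y₁ ∩ (Y₂ − t)` is either empty or of pure
dimension `q` (the slices of `σ⁻¹(Y₁ × Y₂)`, `ae_hasPureDim_fibreSlice`).
[cite: Fulton1998, Appendix B.9.2 (a)] [cite: Kleiman1974Transversality, Thm. 2 (i)] -/
theorem ae_inter_translate_eq_empty_or_hasPureDim (hdim : d₁ + d₂ = q + finrank ℂ E)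
    {Y₁ Y₂ : Set (ComplexTorus Φ)} (hY₁ : HasPureDim 𝓘(ℂ, E) Y₁ d₁) (hY₂ : HasPureDim 𝓘(ℂ, E) Y₂ d₂) :
    ∀ᵐ t ∂(volume : Measure (ComplexTorus Φ)),
      Y₁ ∩ (fun x ↦ x + t) ⁻¹' Y₂ = ∅ ∨ HasPureDim 𝓘(ℂ, E) (Y₁ ∩ (fun x ↦ x + t) ⁻¹' Y₂) q := by
  haveI := isAddHaarMeasure_euclideanHausdorffMeasure_two_mul_finrank (E := E)
  have hW : HasPureDim 𝓘(ℂ, WithLp 2 (E × E))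
      (mapMatrix (prodPeriodL2 Φ Φ) (prodPeriodL2 Φ Φ) (Matrix.fromBlocks 1 0 1 1) ⁻¹'
        (prodHomeomorphL2 Φ Φ ⁻¹' (Y₁ ×ˢ Y₂))) (q + finrank ℂ E) :=
    hdim ▸ (isIsogeny_prodPeriodL2_shear Φ).hasPureDim_preimage (prodPeriodL2 Φ Φ) (prodPeriodL2 Φ Φ)
      (hasPureDim_preimage_prodHomeomorphL2_prod Φ Φ hY₁ hY₂)
  refine ae_volume_of_ae_cover Φ (μ := (μHE[2 * finrank ℂ E] : Measure E))
    (p := fun s ↦ Y₁ ∩ (fun x ↦ x + s) ⁻¹' Y₂ = ∅ ∨ HasPureDim 𝓘(ℂ, E) (Y₁ ∩ (fun x ↦ x + s) ⁻¹' Y₂) q) ?_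
  filter_upwards [ae_hasPureDim_fibreSlice Φ Φ (μHE[2 * finrank ℂ E] : Measure E) hW] with t ht
  have h := ht.2.2
  rw [shear_preimage_prod_fibre] at h
  exact h

include e in
open Classical in
/-- **The a.e. dichotomy**: for `Y₁, Y₂ ⊆ X` closed analytic of pure dimensions `d₁, d₂`, codimensions
`p₁, p₂`, `q = d₁ + d₂ − dim X > 0`, EITHER `Y₁ ∩ (Y₂ − t) = ∅` for a.e. `t ∈ X`, OR `Y₁ ∩ (Y₂ − t)` is
(non-empty and) of pure dimension `q` for a.e. `t ∈ X` — according as `[Y₁] ∧ [Y₂]` vanishes or not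
(the two criteria below). [cite: Fulton1998, Appendix B.9.2 (a) and Example 11.4.5]
[cite: Kleiman1974Transversality, Thm. 2] -/
theorem ae_inter_translate_eq_empty_or_ae_hasPureDim (hk₁ : 2 * d₁ + 2 * p₁ = n) (hk₂ : 2 * d₂ + 2 * p₂ = n)
    (hq : 2 * q + 2 * (p₁ + p₂) = n) (hq₀ : 0 < q) {Y₁ Y₂ : Set (ComplexTorus Φ)}
    (hY₁ : HasPureDim 𝓘(ℂ, E) Y₁ d₁) (hY₂ : HasPureDim 𝓘(ℂ, E) Y₂ d₂) :
    (∀ᵐ t ∂(volume : Measure (ComplexTorus Φ)), Y₁ ∩ (fun x ↦ x + t) ⁻¹' Y₂ = ∅) ∨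
      ∀ᵐ t ∂(volume : Measure (ComplexTorus Φ)), HasPureDim 𝓘(ℂ, E) (Y₁ ∩ (fun x ↦ x + t) ⁻¹' Y₂) q := by
  have hng : finrank ℂ E * 2 = n := finrank_complex_mul_two Φ e
  have hdim : d₁ + d₂ = q + finrank ℂ E := by omega
  have hgen := ae_inter_translate_eq_empty_or_hasPureDim Φ hdim hY₁ hY₂
  have hcl := ae_setCycleClass_inter_translate_eq Φ e hk₁ hk₂ hq hq₀ hY₁ hY₂
  by_cases hR : ((analyticCycleClass Φ e hk₁ hY₁).wedge (analyticCycleClass Φ e hk₂ hY₂)) = 0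
  · left
    filter_upwards [hgen, hcl] with t ht ht'
    rcases ht with h | h
    · exact h
    · exfalso
      rw [setCycleClass_of_hasPureDim Φ e hq h, hR, domDomCongr_finCongr_zero, smul_zero] at ht'
      exact analyticCycleClass_ne_zero Φ e hq h ht'
  · right
    filter_upwards [hgen, hcl] with t ht ht'
    rcases ht with h | h
    · exfalso
      apply hR
      rw [h, setCycleClass_empty] at ht'
      have hss : ((orientationSign Φ e : ℤ) : ℂ) * orientationSign Φ e = 1 := by
        exact_mod_cast orientationSign_mul_self Φ e
      have h0 := congrArg ((orientationSign Φ e : ℂ) • ·) ht'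
      simp only [smul_smul, hss, one_smul] at h0
      rw [smul_zero] at h0
      exact (domDomCongr_finCongr_eq_zero_iff _).1 h0.symm
    · exact h

open Classical in
/-- **`[Y₁] ∧ [Y₂] = 0` iff `Y₁` misses almost every translate of `Y₂`** (`q = d₁ + d₂ − dim X > 0`):
a non-empty closed analytic subset of pure dimension `q` has a non-zero class, so by the moving lemma the
cup product vanishes exactly when a.e. intersection `Y₁ ∩ (Y₂ − t)` is empty.
[cite: Fulton1998, Example 11.4.5 and Appendix B.9.2] [cite: Kleiman1974Transversality, Thm. 2] -/
theorem wedge_analyticCycleClass_eq_zero_iff_ae_inter_translate_eq_empty (hk₁ : 2 * d₁ + 2 * p₁ = n)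
    (hk₂ : 2 * d₂ + 2 * p₂ = n) (hq : 2 * q + 2 * (p₁ + p₂) = n) (hq₀ : 0 < q) {Y₁ Y₂ : Set (ComplexTorus Φ)}
    (hY₁ : HasPureDim 𝓘(ℂ, E) Y₁ d₁) (hY₂ : HasPureDim 𝓘(ℂ, E) Y₂ d₂) :
    (analyticCycleClass Φ e hk₁ hY₁).wedge (analyticCycleClass Φ e hk₂ hY₂) = 0 ↔
      ∀ᵐ t ∂(volume : Measure (ComplexTorus Φ)), Y₁ ∩ (fun x ↦ x + t) ⁻¹' Y₂ = ∅ := by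
  have hcl := ae_setCycleClass_inter_translate_eq Φ e hk₁ hk₂ hq hq₀ hY₁ hY₂
  have hgen := ae_inter_translate_eq_empty_or_hasPureDim Φ
    (by have := finrank_complex_mul_two Φ e; omega : d₁ + d₂ = q + finrank ℂ E) hY₁ hY₂
  constructor
  · intro hR
    filter_upwards [hgen, hcl] with t ht ht'
    rcases ht with h | h
    · exact h
    · exfalso
      rw [setCycleClass_of_hasPureDim Φ e hq h, hR, domDomCongr_finCongr_zero, smul_zero] at ht'
      exact analyticCycleClass_ne_zero Φ e hq h ht'
  · intro hempty
    have hss : ((orientationSign Φ e : ℤ) : ℂ) * orientationSign Φ e = 1 := by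
      exact_mod_cast orientationSign_mul_self Φ e
    have hboth : ∀ᵐ t ∂(volume : Measure (ComplexTorus Φ)),
        ((analyticCycleClass Φ e hk₁ hY₁).wedge (analyticCycleClass Φ e hk₂ hY₂)).domDomCongr
          (finCongr (by ring : 2 * p₁ + 2 * p₂ = 2 * (p₁ + p₂))) = 0 := by
      filter_upwards [hempty, hcl] with t ht ht'
      rw [ht, setCycleClass_empty] at ht'
      have h0 := congrArg ((orientationSign Φ e : ℂ) • ·) ht'
      simp only [smul_smul, hss, one_smul] at h0
      rw [smul_zero] at h0
      exact h0.symm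
    obtain ⟨t, ht⟩ := hboth.exists
    exact (domDomCongr_finCongr_eq_zero_iff _).1 ht

open Classical in
/-- **`[Y₁] ∧ [Y₂] ≠ 0` iff `Y₁` meets almost every translate of `Y₂` in the expected pure dimension**
(`q = d₁ + d₂ − dim X > 0`). [cite: Fulton1998, Example 11.4.5 and Appendix B.9.2]
[cite: Kleiman1974Transversality, Thm. 2] -/
theorem wedge_analyticCycleClass_ne_zero_iff_ae_hasPureDim_inter_translate (hk₁ : 2 * d₁ + 2 * p₁ = n)
    (hk₂ : 2 * d₂ + 2 * p₂ = n) (hq : 2 * q + 2 * (p₁ + p₂) = n) (hq₀ : 0 < q) {Y₁ Y₂ : Set (ComplexTorus Φ)}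
    (hY₁ : HasPureDim 𝓘(ℂ, E) Y₁ d₁) (hY₂ : HasPureDim 𝓘(ℂ, E) Y₂ d₂) :
    (analyticCycleClass Φ e hk₁ hY₁).wedge (analyticCycleClass Φ e hk₂ hY₂) ≠ 0 ↔
      ∀ᵐ t ∂(volume : Measure (ComplexTorus Φ)), HasPureDim 𝓘(ℂ, E) (Y₁ ∩ (fun x ↦ x + t) ⁻¹' Y₂) q := by
  rw [Ne, wedge_analyticCycleClass_eq_zero_iff_ae_inter_translate_eq_empty Φ e hk₁ hk₂ hq hq₀ hY₁ hY₂]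
  constructor
  · intro hne
    rcases ae_inter_translate_eq_empty_or_ae_hasPureDim Φ e hk₁ hk₂ hq hq₀ hY₁ hY₂ with h | h
    · exact absurd h hne
    · exact h
  · intro hpure hempty
    obtain ⟨t, ht, ht'⟩ := (hpure.and hempty).exists
    exact ht.nonempty.ne_empty ht'

open Classical in
/-- **The product of two effective analytic classes is `0` or effective**: if `[Y₁] ∧ [Y₂] ≠ 0`
(`q = d₁ + d₂ − dim X > 0`), there is a translate `t` (in fact a.e. `t`) for which `Y₁ ∩ (Y₂ − t)` is a
closed analytic subset of pure dimension `q` and `[Y₁]_e ∧ [Y₂]_e = sign(e) · [Y₁ ∩ (Y₂ − t)]_e`.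
[cite: Fulton1998, Example 11.4.5] [cite: Kleiman1974Transversality, Thm. 2]
[cite: Lange2023AbelianVarietiesComplex, §7.3.1] -/
theorem exists_wedge_analyticCycleClass_eq_smul_analyticCycleClass_inter_translate
    (hk₁ : 2 * d₁ + 2 * p₁ = n) (hk₂ : 2 * d₂ + 2 * p₂ = n) (hq : 2 * q + 2 * (p₁ + p₂) = n) (hq₀ : 0 < q)
    {Y₁ Y₂ : Set (ComplexTorus Φ)} (hY₁ : HasPureDim 𝓘(ℂ, E) Y₁ d₁) (hY₂ : HasPureDim 𝓘(ℂ, E) Y₂ d₂)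
    (hne : (analyticCycleClass Φ e hk₁ hY₁).wedge (analyticCycleClass Φ e hk₂ hY₂) ≠ 0) :
    ∃ (t : ComplexTorus Φ) (h : HasPureDim 𝓘(ℂ, E) (Y₁ ∩ (fun x ↦ x + t) ⁻¹' Y₂) q),
      ((analyticCycleClass Φ e hk₁ hY₁).wedge (analyticCycleClass Φ e hk₂ hY₂)).domDomCongr
          (finCongr (by ring : 2 * p₁ + 2 * p₂ = 2 * (p₁ + p₂))) =
        (orientationSign Φ e : ℂ) • analyticCycleClass Φ e hq h := by
  have hpure := (wedge_analyticCycleClass_ne_zero_iff_ae_hasPureDim_inter_translate Φ e hk₁ hk₂ hq hq₀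
    hY₁ hY₂).1 hne
  have hcl := ae_wedge_analyticCycleClass_eq_smul_setCycleClass_inter_translate Φ e hk₁ hk₂ hq hq₀ hY₁ hY₂
  obtain ⟨t, ht, ht'⟩ := (hpure.and hcl).exists
  exact ⟨t, ht, by rw [ht', setCycleClass_of_hasPureDim Φ e hq ht]⟩

end Moving

/-! ### §3 Chow's moving lemma: a.e. translate has the same class and meets `Y₁` properly -/

section Chow

open scoped Pointwise

variable {ι : Type*} [Fintype ι] [DecidableEq ι] {E : Type u} [NormedAddCommGroup E] [InnerProductSpace ℂ E]
  [FiniteDimensional ℂ E] [MeasurableSpace E] [BorelSpace E] (Φ : (ι → ℝ) ≃L[ℝ] E) {n : ℕ} (e : Fin n ≃ ι)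
  {d₁ d₂ k₂ q : ℕ}

omit [Fintype ι] [DecidableEq ι] [FiniteDimensional ℂ E] [MeasurableSpace E] [BorelSpace E] in
/-- `Y − t` as a translate: `{x | x + t ∈ Y} = (−t) +ᵥ Y`. [folklore] -/
private theorem preimage_add_right_eq_neg_vadd (Y : Set (ComplexTorus Φ)) (t : ComplexTorus Φ) :
    (fun x ↦ x + t) ⁻¹' Y = (-t) +ᵥ Y := by
  ext x
  simp only [mem_preimage, Set.mem_vadd_set, vadd_eq_add]
  constructor
  · intro hx
    exact ⟨x + t, hx, by abel⟩
  · rintro ⟨y, hy, rfl⟩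
    rwa [show -t + y + t = y by abel]

open Classical in
/-- **CHOW'S MOVING LEMMA ON A COMPLEX TORUS (a.e. form).** For closed analytic `Y₁, Y₂ ⊆ X` of pure
dimensions `d₁, d₂` with `d₁ + d₂ = q + dim X`, for Haar-a.e. `t ∈ X` the translate `t +ᵥ Y₂` — a closed
analytic subset of pure dimension `d₂` with THE SAME CLASS, `[t +ᵥ Y₂]_e = [Y₂]_e`
(`analyticCycleClass_vadd`) — meets `Y₁` properly: `Y₁ ∩ (t +ᵥ Y₂)` is empty or of pure dimension `q`.
Fulton, §11.4 (moving lemma) with Example 11.4.5 / Appendix B.9.2 (Kleiman: translates by a transitive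
group action). [cite: Fulton1998, §11.4, Example 11.4.5 and Appendix B.9.2 (a)]
[cite: Kleiman1974Transversality, Thm. 2 (i)] [cite: Lange2023AbelianVarietiesComplex, §6.2.1 and Ex. 6.2.5 (1)] -/
theorem ae_analyticCycleClass_vadd_eq_and_inter_eq_empty_or_hasPureDim (hk₂ : 2 * d₂ + k₂ = n)
    (hdim : d₁ + d₂ = q + finrank ℂ E) {Y₁ Y₂ : Set (ComplexTorus Φ)} (hY₁ : HasPureDim 𝓘(ℂ, E) Y₁ d₁)
    (hY₂ : HasPureDim 𝓘(ℂ, E) Y₂ d₂) :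
    ∀ᵐ t ∂(volume : Measure (ComplexTorus Φ)),
      analyticCycleClass Φ e hk₂ (hasPureDim_vadd Φ hY₂ t) = analyticCycleClass Φ e hk₂ hY₂ ∧
        (Y₁ ∩ (t +ᵥ Y₂) = ∅ ∨ HasPureDim 𝓘(ℂ, E) (Y₁ ∩ (t +ᵥ Y₂)) q) := by
  -- Haar measure is invariant under `t ↦ -t`
  have hneg : ∀ᵐ t ∂(volume : Measure (ComplexTorus Φ)),
      Y₁ ∩ ((-t : ComplexTorus Φ) +ᵥ Y₂) = ∅ ∨ HasPureDim 𝓘(ℂ, E) (Y₁ ∩ ((-t : ComplexTorus Φ) +ᵥ Y₂)) q := by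
    filter_upwards [ae_inter_translate_eq_empty_or_hasPureDim Φ hdim hY₁ hY₂] with t ht
    rwa [preimage_add_right_eq_neg_vadd] at ht
  have hneg' : ∀ᵐ t ∂(volume : Measure (ComplexTorus Φ)),
      Y₁ ∩ (t +ᵥ Y₂) = ∅ ∨ HasPureDim 𝓘(ℂ, E) (Y₁ ∩ (t +ᵥ Y₂)) q := by
    rw [ae_iff] at hneg ⊢
    rw [← Measure.measure_preimage_neg (volume : Measure (ComplexTorus Φ))]
    exact hneg
  filter_upwards [hneg'] with t ht
  exact ⟨analyticCycleClass_vadd Φ e hk₂ hY₂ t, ht⟩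

open Classical in
/-- **CHOW'S MOVING LEMMA ON A COMPLEX TORUS**: some translate `t +ᵥ Y₂`, with the same class
`[t +ᵥ Y₂]_e = [Y₂]_e`, meets `Y₁` properly (`Y₁ ∩ (t +ᵥ Y₂)` empty or of the expected pure dimension
`q = d₁ + d₂ − dim X`). [cite: Fulton1998, §11.4 and Example 11.4.5] [cite: Kleiman1974Transversality, Thm. 2 (i)]
[cite: Lange2023AbelianVarietiesComplex, §6.2.1 and Ex. 6.2.5 (1)] -/
theorem exists_analyticCycleClass_vadd_eq_and_inter_eq_empty_or_hasPureDim (hk₂ : 2 * d₂ + k₂ = n)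
    (hdim : d₁ + d₂ = q + finrank ℂ E) {Y₁ Y₂ : Set (ComplexTorus Φ)} (hY₁ : HasPureDim 𝓘(ℂ, E) Y₁ d₁)
    (hY₂ : HasPureDim 𝓘(ℂ, E) Y₂ d₂) :
    ∃ t : ComplexTorus Φ,
      analyticCycleClass Φ e hk₂ (hasPureDim_vadd Φ hY₂ t) = analyticCycleClass Φ e hk₂ hY₂ ∧
        (Y₁ ∩ (t +ᵥ Y₂) = ∅ ∨ HasPureDim 𝓘(ℂ, E) (Y₁ ∩ (t +ᵥ Y₂)) q) :=
  (ae_analyticCycleClass_vadd_eq_and_inter_eq_empty_or_hasPureDim Φ e hk₂ hdim hY₁ hY₂).exists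

end Chow

end ComplexTorus

end Literature.Geometry.Kaehler
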